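import Summits.QuantumFields.YangMills.Theorems.SwapVirialDeficitBlowUpVirialRing
import HarnessLib

/-!
# ⟨24197⟩ `SwapGluedStiffness` FOLLOWS BY NAME FROM THE VIRIAL-WINDOW INEQUALITY (file D2, capstone of the V2′ assembly of fcl-p3 g45's virial SPEC,
# memo2-24197-window v2 §2′; free-hands support of ⟨stmt-QuantumFields-24197⟩ `SwapVirialDeficit.SwapGluedStiffness`)

The crux ⟨24197⟩ asks, on a deep window `L₀ ≤ L ≤ β^a`, `β ≥ β₀`, for `β·(log Z^S(L,·,2L))′(β) ≤ 12βL⁴ − 9L⁴ + 3/2 − c`.  By ✓`SwapRing.mul_deriv_log_twistTrace_eq`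
the left side is `12βL⁴ − β·Σ_z E_z(β)/Σ_z Z_z(β)`, and by the virial identity on the ring ✓`BlowUpRing.virial_ring'` each sector mean action decomposes EXACTLY as
`β·E_z = (9L⁴ − 1)·Z_z − K_L·(½⟪W⟫_z − β⟪R⟫_z)` (second-order Euler weight `W = gnoW ≥ 0`, third-order remainder `R = F̂ − ½XF̂`, chart constant `K_L`).  Hence:
* (VW) THE VIRIAL-WINDOW INEQUALITY (the hypothesis `hVW`, stated inline): `∃ a > 0, c > 0, β₀, L₀` such that on the window
  `K_L · Σ_z (½⟪W⟫_{z,β} − β⟪R⟫_{z,β}) ≤ (1/2 − c) · Σ_z Z_z(β)` — in Gibbs-mean words `½⟨W⟩_β − β⟨R⟩_β ≤ 1/2 − c` for the sector mixture; this is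
  the memo's (W)/(V4′) row — OPEN.  Expected suppliers (w2 g57 memo2-virial-window-row-split + fcl-p3 g46's check): the FOLLOWERS' share of `⟨W⟩` and of the
  small-field and large-field remainder is free (pointwise `W_F ≤ poly(L)·F̂` by ✓`chartBox_of_chartDeficit`, thermodynamic sandwich, crude energy bound); what is left is the
  VALLEY TERM of the four leader letters (a window-uniform two-scale analysis of a FIXED finite-dimensional integral with `poly(L)` stiffness constants);
* `sum_virial_ring` (`β·Σ_z E_z = (9L⁴−1)·Σ_z Z_z − K_L·Σ_z(½⟪W⟫_z − β⟪R⟫_z)`), ★★★ `swapGluedStiffness_of_virialWindow (hVW) : Theses.SwapVirialDeficit.SwapGluedStiffness`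
  — the crux by name from (VW) (same `a, c`; `β₀ ↦ max β₀ 1`).
HONEST LABEL: a REDUCTION, proved; its hypothesis (VW) (uniform-in-`L` control of two explicit chart functionals — in Gibbs-mean words `½⟨W⟩_β − β⟨R⟩_β ≤ 1/2 − c`
for the σ-glued sector mixture on the window) is NOT proved and is the crux-level input; ⟨24197⟩ ∕ ⟨24194⟩ ∕ ⟨24196⟩ ∕ ⟨24497⟩ stay OPEN; the Yang–Mills mass gap is NOT proved; no summit is proved by a line.  Seat ym-line-fcl-p3 g46 (cell ym-idea-1,
free hands; item of record ⟨24085⟩ aside, untouched), `--supports stmt-QuantumFields-24197`.  THEOREMS ONLY (hypothesis inline, as in ✓`…SwapGluedStiffnessOfPrincipalAndMinus`); 0 `sorry`;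
standard axioms; the series' local `ℍ` instances.  References: [cite: tHooft1979]; [cite: Luscher1983, §2]; [folklore] (virial ∕ Euler identity by scaling).
-/

set_option autoImplicit false
set_option synthInstance.maxSize 1024

noncomputable section

open MeasureTheory Quaternion Set Filter Topology
open scoped Quaternion BigOperators
open Literature.MathematicalPhysics.QuantumLattice
open Literature.MathematicalPhysics.QuantumFieldTheory hiding SU2
open Summit.QuantumFields.YangMills.Theorems.FemtoTransferGap
open Summit.QuantumFields.YangMills.Theorems.FemtoTransferGap.TT
open Summit.QuantumFields.YangMills.Theorems.VirialFluxGap.RingDeficit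
open Summit.QuantumFields.YangMills.Theorems.SwapTwistDeficit.ToronLog (coneMeasure coneConst isProbabilityMeasure_coneMeasure)
open Summit.QuantumFields.YangMills.Theorems.SwapVirialDeficit.SwapRing

attribute [local instance] Literature.Analysis.FluidPDE.Tao2016.quatMeasurableSpace
  Literature.Analysis.FluidPDE.Tao2016.quatBorelSpace
  Literature.MathematicalPhysics.QuantumLattice.secondCountableTopology_su2

namespace Summit.QuantumFields.YangMills.Theorems.SwapVirialDeficit.BlowUpRing

/-- ★ **The sector sum of the virial identity**: `β·Σ_z E_z(β) = (9L⁴ − 1)·Σ_z Z_z(β) − K_L·Σ_z (½⟪W⟫_z − β⟪R⟫_z)` (`β > 0`). [folklore] -/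
theorem sum_virial_ring {L : ℕ} [NeZero L] {β : ℝ} (hβ : 0 < β) :
    β * ∑ z : Fin 3 → Bool, ∫ p, swapRingDeficit L z p * Real.exp (-(β * swapRingDeficit L z p)) ∂(ringMeasure L) =
      (9 * (L : ℝ) ^ 4 - 1) * ∑ z : Fin 3 → Bool, ∫ p, Real.exp (-(β * swapRingDeficit L z p)) ∂(ringMeasure L)
        - (coneConst ^ 3 / 64 * (1 / (2 * Real.pi ^ 2)) ^ Fintype.card (Fol L)) *
          ∑ z : Fin 3 → Bool,
            (1 / 2 * (∫ a, (∑ ε : GnoSign L, ∫ η : GnoCoord L,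
                gnoW η * Real.exp (-(β * gnoDeficit z (fun _ => 1) a ε η)) * gnoDensity η) ∂coneMeasure)
              - β * (∫ a, (∑ ε : GnoSign L, ∫ η : GnoCoord L,
                (gnoDeficit z (fun _ => 1) a ε η - gnoXDeficit z (fun _ => 1) a ε η / 2) *
                  Real.exp (-(β * gnoDeficit z (fun _ => 1) a ε η)) * gnoDensity η) ∂coneMeasure)) := by
  rw [Finset.mul_sum, Finset.mul_sum, Finset.mul_sum, ← Finset.sum_sub_distrib]
  refine Finset.sum_congr rfl fun z _ => ?_
  rw [virial_ring' z hβ, half_two_alpha_eq]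
  ring

/-- ★★★ **⟨24197⟩ `SwapGluedStiffness` FROM THE VIRIAL-WINDOW INEQUALITY (VW), BY NAME**.  (VW): there are `a > 0`, `c > 0`, `β₀`, `L₀` such that for
`β ≥ β₀` and `L₀ ≤ L ≤ β^a`, `K_L · Σ_z (½⟪W⟫_{z,β} − β⟪R⟫_{z,β}) ≤ (1/2 − c) · Σ_z Z_z(β)`, where `Z_z(β) = ∫ e^{−βF^S_z} dμ_L`,
`⟪W⟫_{z,β} = ∫ a, Σ_ε ∫ gnoW·e^{−βF̂_{z,a,ε}}·ρ ∂cone` (second-order Euler weight), `⟪R⟫_{z,β} = ∫ a, Σ_ε ∫ (F̂ − ½XF̂)·e^{−βF̂}·ρ ∂cone` (third-order remainder;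
principal character `χ ≡ 1`), `K_L = coneConst³/64·(2π²)^{−|Fol L|}` — in Gibbs-mean words `½⟨W⟩_β − β⟨R⟩_β ≤ 1/2 − c` for the sector mixture.  Then on the window
`β·(log Z^S)′(β) = 12βL⁴ − (9L⁴ − 1) + K_L·Σ_z(½⟪W⟫_z − β⟪R⟫_z)/Σ_z Z_z ≤ 12βL⁴ − 9L⁴ + 3/2 − c` (✓`SwapRing.mul_deriv_log_twistTrace_eq`, `sum_virial_ring`).
(VW) is OPEN (it is where uniform-in-`L` control enters); this is a reduction, not a proof of the crux. [cite: tHooft1979] [cite: Luscher1983, §2] -/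
theorem swapGluedStiffness_of_virialWindow
    (hVW : ∃ a : ℝ, 0 < a ∧ ∃ c : ℝ, 0 < c ∧ ∃ β₀ : ℝ, ∃ L₀ : ℕ, ∀ β : ℝ, β₀ ≤ β → ∀ (L : ℕ) [NeZero L], L₀ ≤ L → (L : ℝ) ≤ β ^ a →
      (coneConst ^ 3 / 64 * (1 / (2 * Real.pi ^ 2)) ^ Fintype.card (Fol L)) *
          ∑ z : Fin 3 → Bool,
            (1 / 2 * (∫ a, (∑ ε : GnoSign L, ∫ η : GnoCoord L,
                gnoW η * Real.exp (-(β * gnoDeficit z (fun _ => 1) a ε η)) * gnoDensity η) ∂coneMeasure)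
              - β * (∫ a, (∑ ε : GnoSign L, ∫ η : GnoCoord L,
                (gnoDeficit z (fun _ => 1) a ε η - gnoXDeficit z (fun _ => 1) a ε η / 2) *
                  Real.exp (-(β * gnoDeficit z (fun _ => 1) a ε η)) * gnoDensity η) ∂coneMeasure)) ≤
        (1 / 2 - c) * ∑ z : Fin 3 → Bool, ∫ p, Real.exp (-(β * swapRingDeficit L z p)) ∂(ringMeasure L)) :
    Summit.QuantumFields.YangMills.Theses.SwapVirialDeficit.SwapGluedStiffness := by
  obtain ⟨a, ha, c, hc, β₀, L₀, hW⟩ := hVW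
  refine ⟨a, ha, c, hc, max β₀ 1, L₀, fun β hβ L _ hL hLβ => ?_⟩
  have hβ₀ : β₀ ≤ β := (le_max_left _ _).trans hβ
  have hβ1 : (1 : ℝ) ≤ β := (le_max_right _ _).trans hβ
  have hβpos : 0 < β := lt_of_lt_of_le one_pos hβ1
  have hVW := hW β hβ₀ L hL hLβ
  -- abbreviations: sector sums
  set S : ℝ := ∑ z : Fin 3 → Bool, ∫ p, Real.exp (-(β * swapRingDeficit L z p)) ∂(ringMeasure L) with hS
  set E : ℝ := ∑ z : Fin 3 → Bool, ∫ p, swapRingDeficit L z p * Real.exp (-(β * swapRingDeficit L z p)) ∂(ringMeasure L) with hE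
  set Q : ℝ := (coneConst ^ 3 / 64 * (1 / (2 * Real.pi ^ 2)) ^ Fintype.card (Fol L)) *
    ∑ z : Fin 3 → Bool,
      (1 / 2 * (∫ a, (∑ ε : GnoSign L, ∫ η : GnoCoord L,
          gnoW η * Real.exp (-(β * gnoDeficit z (fun _ => 1) a ε η)) * gnoDensity η) ∂coneMeasure)
        - β * (∫ a, (∑ ε : GnoSign L, ∫ η : GnoCoord L,
          (gnoDeficit z (fun _ => 1) a ε η - gnoXDeficit z (fun _ => 1) a ε η / 2) *
            Real.exp (-(β * gnoDeficit z (fun _ => 1) a ε η)) * gnoDensity η) ∂coneMeasure)) with hQ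
  have hSpos : 0 < S := sum_integral_exp_swapDeficit_pos (L := L) β
  have hvir : β * E = (9 * (L : ℝ) ^ 4 - 1) * S - Q := sum_virial_ring (L := L) hβpos
  have hQS : Q / S ≤ 1 / 2 - c := by rw [div_le_iff₀ hSpos]; exact hVW
  rw [mul_deriv_log_twistTrace_eq]
  have hkey : β * (E / S) = (9 * (L : ℝ) ^ 4 - 1) - Q / S := by
    rw [← mul_div_assoc, hvir]
    field_simp
  rw [hkey]
  linarith

end Summit.QuantumFields.YangMills.Theorems.SwapVirialDeficit.BlowUpRing

end
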